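import Summits.ValiantsHypothesis.ValiantsHypothesis.Theorems.NewtonUnitEquationsTwoProductsTowerRecordLiftClassSum
import Summits.ValiantsHypothesis.ValiantsHypothesis.Theorems.NewtonUnitEquationsTwoProductsMomentRecordLiftRecord

/-!
# R13 lift toolkit — the tower record of a visible point; the transfers (A_D) ⇒ (B_D) and (A_E) ⇒ (B_E)

(L3/3) **THE TOWER RECORD OF A VISIBLE POINT** (`exists_liveTopT_of_isStrictTop`, `exists_isRecordT_of_isStrictTop`): for a normalised instance with
tail alphabet in the tower `⊔_{j ∈ E} (X + j•d)`, `E ⊆ [0, D]`, tower-dissociated to depth `(m, D)`, a valid `ξ` and a strict `ξ`-top `l` of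
`supp(Π(1+u) − Π(1+v))`, the tower-shallow exponent over `l` is LIVE for the tower data of the instance and a RECORD `IsRecordT` for the same real
`ξ` (no sign hypothesis is needed or produced); reindexing to the `≤ 2mt` occurring carriers (`exists_reindexT`); ★ `card_cellFamily_le_records` (a cell
family injects into the records of the tower data); and the two transfers typed in ✓ `…TowerRecordDefs`:
★★ `towerCarrier_of_towerRecord_holds : towerCarrier_of_towerRecord` and ★★ `sparseLevelCarrier_of_sparseLevelRecord_holds (ℓ)`.
Degree-`D` version of R12's ✓ `…MomentRecordLiftRecord` (val-lit-p3 g17), whose reindexing helpers `extC`/`size_extC`/`ptZ_extC` are imported by name.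
Helper on crux `stmt-ValiantsHypothesis-5906` (line `relation_ladder`, R13 «tower record law», texts ✓ `…TowerRecordDefs` (val-idea-37 g4 / crit-8 g2));
`--supports`, closes nothing by itself.  HONEST LABEL (crit-8 #19): the rungs these transfers feed (`TowerCarrierLaw`, `SparseLevelCarrierLaw ℓ`) are
WIDER CLASS rungs (dense parallel towers on dissociated carriers / boundedly many levels), INERT AS A HATCH; F10's collinear digit towers and fibre
lumping NOT covered; `PlanarCellBound`, `ResidualLawV24`, the crux (stmt-5906) and every summit statement UNMOVED; VP ≠ VNP is NOT proved.
No instances, no notation, no named facts. [folklore]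
-/

set_option linter.dupNamespace false

noncomputable section

open Classical

namespace Summit.ValiantsHypothesis.ValiantsHypothesis.Theorems.NewtonUnitEquations.TwoProducts.TowerRecord.Lift
open scoped BigOperators
open MvPolynomial
open Summit.ValiantsHypothesis.ValiantsHypothesis.Theorems.NewtonUnitEquations.TwoProducts.FormalLogLinearisation
open Summit.ValiantsHypothesis.ValiantsHypothesis.Theorems.NewtonUnitEquations.TwoProducts.PlanarCell
open Summit.ValiantsHypothesis.ValiantsHypothesis.Theorems.NewtonUnitEquations.TwoProducts.MomentRecord
open Summit.ValiantsHypothesis.ValiantsHypothesis.Theorems.NewtonUnitEquations.TwoProducts.MomentRecord.Lift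
open Summit.ValiantsHypothesis.ValiantsHypothesis.Theorems.NewtonUnitEquations.TwoProducts.TowerRecord

section RecordFile

/-! ## The tower record of a visible point -/

section Record

variable {m n : ℕ}
variable {u v : Fin m → MvPolynomial (Fin 2) ℂ} {x : Fin n → Expo} {d : Fin 2 → ℤ} {E : Finset ℕ} {D : ℕ}

/-- The empty carrier multiset carries no tower layer: `layerT k 0 = 0`. [folklore] -/
theorem layerT_eq_zero_of_ydeg_eq_zero (γ γ' : Fin m → Fin n → Polynomial ℂ) {Ex : Option (Fin n) →₀ ℕ} (hE : ydeg Ex = 0) (k : ℕ) :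
    layerT γ γ' k (fun i => Ex (some i)) = 0 := by
  have h0 : ∀ i, Ex (some i) = 0 := fun i => by
    have := Finset.single_le_sum (f := fun i => Ex (some i)) (fun i _ => Nat.zero_le _) (Finset.mem_univ i)
    rw [show ∑ i, Ex (some i) = ydeg Ex from rfl, hE] at this
    exact Nat.le_zero.mp this
  simp only [layerT, momentPolyT, h0, pow_zero, Finset.prod_const_one, Finset.sum_const, Finset.card_univ, Fintype.card_fin,
    sub_self, Polynomial.coeff_zero]

/-- **THE TOWER RECORD OF A VISIBLE POINT.**  For a normalised instance with tail alphabet in `⊔_{j ∈ E}(X + j•d)`, `E ⊆ [0,D]`, tower-dissociated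
to depth `(m, D)`, a valid weight `ξ` and a strict `ξ`-top `l` of `supp (∏(1+u) − ∏(1+v))`: the unique tower-shallow upstairs exponent `Ex` over `l`
is LIVE for the tower data of the instance and STRICTLY HEAVIER than every other live exponent of any shape. [folklore] -/
theorem exists_liveTopT_of_isStrictTop (hu : ∀ j, coeff 0 (u j) = 0) (hv : ∀ j, coeff 0 (v j) = 0)
    (halph : TowerAlphabet u v x d E) (hED : ∀ j ∈ E, j ≤ D) (hdis : TowerDissociated x d m D)
    {ξ : Fin 2 → ℝ} (hval : ValidWeight u v ξ) {l : Expo} (htop : IsStrictTop ξ (↑(tailDiff u v).support) l) :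
    ∃ Ex : Option (Fin n) →₀ ℕ, ydeg Ex ≤ m ∧ Ex none ≤ D * ydeg Ex ∧ pt x d Ex = ιZ l ∧
      layerT (gammaOf u v x d E u) (gammaOf u v x d E v) (Ex none) (fun i => Ex (some i)) ≠ 0 ∧
      ∀ E' : Option (Fin n) →₀ ℕ, E' ≠ Ex →
        layerT (gammaOf u v x d E u) (gammaOf u v x d E v) (E' none) (fun i => E' (some i)) ≠ 0 →
          wtZ ξ (pt x d E') < wt ξ l := by
  classical
  -- names
  set L := tailSupport u v with hL
  set κ := κw ξ x d with hκ
  set w₀ := wt ξ l with hw₀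
  set γu := gammaOf u v x d E u
  set γv := gammaOf u v x d E v
  have h0 : (0 : Expo) ∉ L := zero_not_mem_tailSupport hu hv
  have huA : ∀ j, (u j).support ⊆ L := fun j e he => Finset.mem_union_left _ (Finset.mem_biUnion.mpr ⟨j, Finset.mem_univ _, he⟩)
  have hvA : ∀ j, (v j).support ⊆ L := fun j e he => Finset.mem_union_right _ (Finset.mem_biUnion.mpr ⟨j, Finset.mem_univ _, he⟩)
  -- (1) the visible point and its tuple
  have hl : coeff l (tailDiff u v) ≠ 0 := mem_support_iff.mp (Finset.mem_coe.mp htop.1)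
  obtain ⟨a₀, ha₀, hsum⟩ : ∃ a ∈ Fintype.piFinset (fun _ : Fin m => insert (0 : Expo) L), ∑ j, a j = l := by
    by_contra hne
    push Not at hne
    apply hl
    rw [tailDiff, coeff_sub, coeff_prod_one_add_eq_fibreSum u _ (fun _ => h0) huA,
      coeff_prod_one_add_eq_fibreSum v _ (fun _ => h0) hvA]
    have hempty : (Fintype.piFinset (fun _ : Fin m => insert (0 : Expo) L)).filter (fun a => ∑ j, a j = l) = ∅ :=
      Finset.filter_eq_empty_iff.mpr fun a ha h => hne a ha h
    rw [hempty, Finset.sum_empty, Finset.sum_empty, sub_self]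
  set Ex := ∑ j, lamT u v x d E (a₀ j) with hEx
  obtain ⟨hEm, hEk⟩ := shallow_tupleExpT halph hED a₀ (u := u) (v := v) (x := x) (d := d)
  have hptE : pt x d Ex = ιZ l := by
    rw [hEx, pt_sum, ← hsum, ιZ_sum]
    refine Finset.sum_congr rfl fun j _ => pt_lamT hu hv halph ?_
    exact Fintype.mem_piFinset.mp ha₀ j
  have hlwE : lw κ Ex = w₀ := by rw [hκ, lw_κw, hptE, wtZ_ιZ]
  -- (2) up = down at `Ex`
  set G := coeff l (tailDiff u v) with hG
  have hcoeffE : coeff Ex (DeltaUpT (u := u) (v := v) (x := x) (d := d) (E := E)) = G := by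
    rw [hEx, coeff_deltaUpT_tupleExp hu hv halph hED hdis ha₀, hsum]
  -- (3) the top congruence for 𝚫
  have htopΔ : TopEq κ w₀ (DeltaUpT (u := u) (v := v) (x := x) (d := d) (E := E)) (monomial Ex G) := by
    intro E' hE'
    rw [coeff_monomial]
    by_cases hc : coeff E' (DeltaUpT (u := u) (v := v) (x := x) (d := d) (E := E)) = 0
    · rw [hc]
      split_ifs with hEE
      · exact absurd (hEE ▸ hcoeffE) (by rw [hc]; exact Ne.symm hl)
      · rfl
    · obtain ⟨b, hb, hbE⟩ := exists_tuple_of_coeff_deltaUpT_ne_zero hu hv hc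
      have hq : coeff (∑ j, b j) (tailDiff u v) ≠ 0 := by
        rwa [← hbE, coeff_deltaUpT_tupleExp hu hv halph hED hdis hb] at hc
      have hptb : pt x d E' = ιZ (∑ j, b j) := by
        rw [← hbE, pt_sum, ιZ_sum]
        exact Finset.sum_congr rfl fun j _ => pt_lamT hu hv halph (Fintype.mem_piFinset.mp hb j)
      have hwq : wt ξ (∑ j, b j) = lw κ E' := by rw [hκ, lw_κw, hptb, wtZ_ιZ]
      have hql : ∑ j, b j = l := by
        by_contra hne
        have := htop.2 _ (Finset.mem_coe.mpr (mem_support_iff.mpr hq)) hne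
        rw [hwq] at this
        exact absurd hE' (not_le.mpr this)
      have hEE : E' = Ex := by
        obtain ⟨s1, s2⟩ := shallow_tupleExpT halph hED b (u := u) (v := v) (x := x) (d := d)
        rw [← hbE]
        refine pt_injOn_towerShallow hdis s1 s2 hEm hEk ?_
        rw [hbE, hptb, hql, hptE]
      subst hEE
      rw [if_pos rfl, hcoeffE]
  -- (4) tameness and the transport
  obtain ⟨c, hc, htame⟩ := exists_tame_liftWT halph hED hval (u := u) (v := v) (x := x) (d := d)
  have htU : ∀ j, Tame κ c (ellUT (u := u) (v := v) (x := x) (d := d) (E := E) j) := fun j => htame u j (huA j)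
  have htV : ∀ j, Tame κ c (ellVT (u := u) (v := v) (x := x) (d := d) (E := E) j) := fun j => htame v j (hvA j)
  have hU0 : ∀ j, coeff 0 (ellUT (u := u) (v := v) (x := x) (d := d) (E := E) j) = 0 := by
    intro j
    rw [ellUT, liftW, coeff_sum]
    refine Finset.sum_eq_zero fun e he => ?_
    rw [coeff_monomial, if_neg]
    intro h0e
    obtain ⟨_, hyd, _⟩ := (isLetterExpT_lamT halph (huA j he)).pt_eq (x := x) (d := d)
    rw [h0e] at hyd
    simp [ydeg] at hyd
  have hV0 : ∀ j, coeff 0 (ellVT (u := u) (v := v) (x := x) (d := d) (E := E) j) = 0 := by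
    intro j
    rw [ellVT, liftW, coeff_sum]
    refine Finset.sum_eq_zero fun e he => ?_
    rw [coeff_monomial, if_neg]
    intro h0e
    obtain ⟨_, hyd, _⟩ := (isLetterExpT_lamT halph (hvA j he)).pt_eq (x := x) (d := d)
    rw [h0e] at hyd
    simp [ydeg] at hyd
  -- the transported congruence, for every admissible `R`, in LAYER form
  have hΛ : ∀ R : ℕ, -w₀ ≤ c * R → ∀ E' : Option (Fin n) →₀ ℕ, w₀ ≤ lw κ E' →
      (if 1 ≤ ydeg E' ∧ ydeg E' ≤ R + 1 then ((-1 : ℂ) ^ (ydeg E' + 1) / (ydeg E' : ℂ)) *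
        (Nat.multinomial Finset.univ (fun i => E' (some i)) : ℂ) * layerT γu γv (E' none) (fun i => E' (some i)) else 0) =
      coeff E' (monomial Ex G) := by
    intro R hR E' hE'
    have ht := topEq_logT_of_topEq_prod hc Finset.univ Finset.univ _ _ hU0 hV0 htU htV hlwE htopΔ hR E' hE'
    simp_rw [ellUT_eq_polyForm halph, ellVT_eq_polyForm halph] at ht
    rw [coeff_logSum_polyForm_sub] at ht
    exact ht
  -- an admissible `R₀`
  obtain ⟨R₀, hR₀⟩ : ∃ R₀ : ℕ, -w₀ ≤ c * R₀ := by
    refine ⟨⌈-w₀ / c⌉₊, ?_⟩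
    have h1 : -w₀ / c ≤ (⌈-w₀ / c⌉₊ : ℝ) := Nat.le_ceil _
    calc -w₀ = c * (-w₀ / c) := by field_simp
      _ ≤ c * ⌈-w₀ / c⌉₊ := by gcongr
  have hRmono : ∀ R : ℕ, R₀ ≤ R → -w₀ ≤ c * R := fun R hR =>
    hR₀.trans (by gcongr)
  -- (5) liveness
  have hEm' : ydeg Ex ≤ m := hEm
  have hEk' : Ex none ≤ D * ydeg Ex := hEk
  have hydE : 1 ≤ ydeg Ex := by
    by_contra hlt
    have hy0 : ydeg Ex = 0 := by omega
    have hE0 : Ex = 0 := by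
      ext w
      cases w with
      | none =>
        have h1 : Ex none ≤ 0 := by simpa [hy0] using hEk'
        exact Nat.le_zero.mp h1
      | some i =>
        have h1 := Finset.single_le_sum (f := fun i => Ex (some i)) (fun i _ => Nat.zero_le _) (Finset.mem_univ i)
        rw [show ∑ i, Ex (some i) = ydeg Ex from rfl, hy0] at h1
        exact Nat.le_zero.mp h1
    have hl0 : l = 0 := by
      apply ιZ_injective
      rw [← hptE, hE0, pt_zero, ιZ_zero]
    apply hl
    rw [hG, hl0, tailDiff, coeff_sub, coeff_zero_prod_one_add _ _ hu, coeff_zero_prod_one_add _ _ hv, sub_self]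
  have hlive : layerT γu γv (Ex none) (fun i => Ex (some i)) ≠ 0 := by
    have h := hΛ (R₀ + m) (hRmono _ (Nat.le_add_right _ _)) Ex hlwE.ge
    rw [coeff_monomial, if_pos rfl, if_pos ⟨hydE, by omega⟩] at h
    intro h0
    rw [h0, mul_zero] at h
    exact hl h.symm
  refine ⟨Ex, hEm', hEk', hptE, hlive, fun E' hne hlive' => ?_⟩
  -- (6) the record inequality
  by_contra hge
  rw [not_lt] at hge
  have hge' : w₀ ≤ lw κ E' := by rw [hκ, lw_κw]; exact hge
  have hyd' : 1 ≤ ydeg E' := by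
    by_contra hlt
    exact hlive' (layerT_eq_zero_of_ydeg_eq_zero _ _ (by omega) _)
  have h := hΛ (R₀ + ydeg E') (hRmono _ (Nat.le_add_right _ _)) E' hge'
  rw [coeff_monomial, if_neg (Ne.symm hne), if_pos ⟨hyd', by omega⟩] at h
  exact (mul_ne_zero (classConst_ne_zero hyd') hlive') h

/-- **THE TOWER RECORD OF A VISIBLE POINT, in the landed vocabulary**: the tower-shallow pair over a strict top lies in the box
`shallowPairsT n m D`, projects to the point, and is an `IsRecordT` of the tower data for the same weight. [folklore] -/
theorem exists_isRecordT_of_isStrictTop (hu : ∀ j, coeff 0 (u j) = 0) (hv : ∀ j, coeff 0 (v j) = 0)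
    (halph : TowerAlphabet u v x d E) (hED : ∀ j ∈ E, j ≤ D) (hdis : TowerDissociated x d m D)
    {ξ : Fin 2 → ℝ} (hval : ValidWeight u v ξ) {l : Expo} (htop : IsStrictTop ξ (↑(tailDiff u v).support) l) :
    ∃ p : (Fin n → ℕ) × ℕ, p ∈ shallowPairsT n m D ∧ ptZ x d p.1 p.2 = ιZ l ∧
      IsRecordT (gammaOf u v x d E u) (gammaOf u v x d E v) x d m ξ p := by
  obtain ⟨Ex, hEm, hEk, hptE, hlive, hrec⟩ := exists_liveTopT_of_isStrictTop hu hv halph hED hdis hval htop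
  refine ⟨(fun i => Ex (some i), Ex none), ?_, by rw [← pt_eq_ptZ, hptE], ?_, ?_⟩
  · rw [shallowPairsT, Finset.mem_product, Fintype.mem_piFinset]
    refine ⟨fun i => Finset.mem_range.mpr (Nat.lt_succ_of_le ?_), Finset.mem_range.mpr (Nat.lt_succ_of_le ?_)⟩
    · exact (Finset.single_le_sum (f := fun i => Ex (some i)) (fun i _ => Nat.zero_le _) (Finset.mem_univ i)).trans hEm
    · exact hEk.trans (Nat.mul_le_mul_left _ hEm)
  · exact ⟨hEm, hlive⟩
  · rintro ⟨S', k'⟩ ⟨_, hlive'⟩ hne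
    set E' : Option (Fin n) →₀ ℕ := embS S' + Finsupp.single none k' with hE'
    have hS' : (fun i => E' (some i)) = S' := funext fun i => by rw [hE', embS_add_single_apply]; rfl
    have hk' : E' none = k' := by rw [hE', embS_add_single_apply]; rfl
    have hne' : E' ≠ Ex := by
      intro h
      apply hne
      rw [Prod.mk.injEq, ← hS', ← hk', h]
      exact ⟨rfl, rfl⟩
    have h := hrec E' hne' (by rw [hS', hk']; exact hlive')
    rw [hE', pt_embS_add_single] at h
    simp only
    rw [← pt_eq_ptZ, hptE, wtZ_ιZ]
    exact h

end Record

/-! ## Reindexing to the occurring carriers; the transfers -/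

section Glue

variable {m n : ℕ}

/-- **Reindexing to the occurring carriers.**  The carriers that occur can be renumbered by `Fin n'` with `n' ≤ #tailSupport`, keeping the tower
alphabet hypothesis and tower dissociation to depth `(m, D)`. [folklore] -/
theorem exists_reindexT {u v : Fin m → MvPolynomial (Fin 2) ℂ} {x : Fin n → Expo} {d : Fin 2 → ℤ} {E : Finset ℕ} {D : ℕ}
    (halph : TowerAlphabet u v x d E) (hdis : TowerDissociated x d m D) :
    ∃ (n' : ℕ) (x' : Fin n' → Expo), n' ≤ (tailSupport u v).card ∧ TowerAlphabet u v x' d E ∧ TowerDissociated x' d m D := by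
  classical
  set L := tailSupport u v with hL
  set car : L → Fin n := fun e => Classical.choose (halph e.1 e.2) with hcar
  have hcar_spec : ∀ e : L, ∃ j ∈ E, ∀ c, ((e.1 c : ℕ) : ℤ) = ((x (car e) c : ℕ) : ℤ) + (j : ℤ) * d c :=
    fun e => Classical.choose_spec (halph e.1 e.2)
  set C : Finset (Fin n) := L.attach.image car with hC
  set x' : Fin C.card → Expo := fun i' => x (C.equivFin.symm i').1 with hx'
  refine ⟨C.card, x', ?_, ?_, ?_⟩
  · exact Finset.card_image_le.trans (by rw [Finset.card_attach])
  · intro e he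
    have hmem : car ⟨e, he⟩ ∈ C := Finset.mem_image.mpr ⟨⟨e, he⟩, Finset.mem_attach _ _, rfl⟩
    refine ⟨C.equivFin ⟨car ⟨e, he⟩, hmem⟩, ?_⟩
    have hxe : x' (C.equivFin ⟨car ⟨e, he⟩, hmem⟩) = x (car ⟨e, he⟩) := by
      rw [hx']; simp
    obtain ⟨j, hj, h⟩ := hcar_spec ⟨e, he⟩
    refine ⟨j, hj, fun c => ?_⟩
    rw [hxe]
    exact h c
  · intro S₁ S₂ k₁ k₂ h1 h2 hk1 hk2 hpt
    have key := hdis (extC C S₁) (extC C S₂) k₁ k₂ (by rw [size_extC]; exact h1) (by rw [size_extC]; exact h2)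
      (by rw [size_extC]; exact hk1) (by rw [size_extC]; exact hk2) (by rw [ptZ_extC, ptZ_extC]; exact hpt)
    refine ⟨funext fun i' => ?_, key.2⟩
    rw [← extC_apply_symm C S₁ i', ← extC_apply_symm C S₂ i', key.1]

/-- **A cell family injects into the records of the tower data.**  For a normalised `t`-sparse instance with tail alphabet in
`⊔_{j ∈ E}(X + j•d)`, `E ⊆ [0, D]`, tower-dissociated to depth `(m, D)`: after reindexing to `n' ≤ 2mt` occurring carriers, every cell family `S`
has `#S ≤ #records` of the tower data `(γ_u, γ_v)` (levels in `E`, degree `≤ D`) in the box `shallowPairsT n' m D`.  (Each point `l ∈ S` is a strict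
top of `logSupport` for the cell's valid `ξ_l`, hence — `stub_logLinearisation` — of `supp(Π(1+u) − Π(1+v))`, hence the image of a record; points ↦
pairs is injective by `ptZ (pair) = l`.) [folklore] -/
theorem card_cellFamily_le_records {t : ℕ} {u v : Fin m → MvPolynomial (Fin 2) ℂ} {x : Fin n → Expo} {d : Fin 2 → ℤ} {E : Finset ℕ} {D : ℕ}
    (hu : ∀ j, coeff 0 (u j) = 0 ∧ (u j).support.card ≤ t) (hv : ∀ j, coeff 0 (v j) = 0 ∧ (v j).support.card ≤ t)
    (halph : TowerAlphabet u v x d E) (hED : ∀ j ∈ E, j ≤ D) (hdis : TowerDissociated x d m D)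
    (R : Expo → Expo → Prop) (S : Finset Expo) (hS : IsCellFamily u v R S) :
    ∃ (n' : ℕ) (x' : Fin n' → Expo), n' ≤ 2 * m * t ∧
      LevelsIn (gammaOf u v x' d E u) E ∧ LevelsIn (gammaOf u v x' d E v) E ∧
      DegLe (gammaOf u v x' d E u) D ∧ DegLe (gammaOf u v x' d E v) D ∧
      S.card ≤ ((shallowPairsT n' m D).filter fun p => ∃ ξ : Fin 2 → ℝ,
        IsRecordT (gammaOf u v x' d E u) (gammaOf u v x' d E v) x' d m ξ p).card := by
  classical
  have hu0 : ∀ j, coeff 0 (u j) = 0 := fun j => (hu j).1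
  have hv0 : ∀ j, coeff 0 (v j) = 0 := fun j => (hv j).1
  obtain ⟨n', x', hn', halph', hdis'⟩ := exists_reindexT halph hdis
  have hn'le : n' ≤ 2 * m * t :=
    hn'.trans (Summit.ValiantsHypothesis.ValiantsHypothesis.Theorems.NewtonUnitEquations.TwoProducts.Submerged.card_tailSupport_le u v t
      (fun j => (hu j).2) fun j => (hv j).2)
  refine ⟨n', x', hn'le, levelsIn_gammaOf u, levelsIn_gammaOf v, degLe_gammaOf hED u, degLe_gammaOf hED v, ?_⟩
  set γu := gammaOf u v x' d E u
  set γv := gammaOf u v x' d E v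
  set Rec := (shallowPairsT n' m D).filter fun p => ∃ ξ : Fin 2 → ℝ, IsRecordT γu γv x' d m ξ p with hRec
  have hrec : ∀ l ∈ S, ∃ p ∈ Rec, ptZ x' d p.1 p.2 = ιZ l := by
    intro l hl
    obtain ⟨ξ, hval, htop, -⟩ := hS l hl
    have htop' : IsStrictTop ξ (↑(tailDiff u v).support) l := (stub_logLinearisation m u v hu0 hv0 ξ hval l).2 htop
    obtain ⟨p, hp, hpt, hrecp⟩ := exists_isRecordT_of_isStrictTop hu0 hv0 halph' hED hdis' hval htop'
    exact ⟨p, Finset.mem_filter.mpr ⟨hp, ξ, hrecp⟩, hpt⟩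
  choose! rep hrep hptrep using hrec
  exact Finset.card_le_card_of_injOn rep (fun l hl => hrep l hl) (fun l₁ h₁ l₂ h₂ h => by
    apply ιZ_injective
    rw [← hptrep l₁ (Finset.mem_coe.mp h₁), ← hptrep l₂ (Finset.mem_coe.mp h₂), h])

/-- **THE TRANSFER (A_D) ⇒ (B_D): `TowerRecordLaw → TowerCarrierLaw`**, with the same constants (typed target `towerCarrier_of_towerRecord` of
✓ `…TowerRecordDefs`, val-idea-37 g4 §9).  The alphabet clause `j ≤ D` is the tower alphabet with `E = [0, D]`.  HONEST LABEL: feeds a wider CLASS rung,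
inert as a hatch; VP ≠ VNP is NOT proved. [folklore] -/
theorem towerCarrier_of_towerRecord_holds : towerCarrier_of_towerRecord := by
  classical
  rintro ⟨a, b, hlaw⟩
  refine ⟨a, b, fun m t n D u v x d _ht hu hv halph hdis R S hS => ?_⟩
  have hED : ∀ j ∈ Finset.range (D + 1), j ≤ D := fun j hj => Nat.le_of_lt_succ (Finset.mem_range.mp hj)
  obtain ⟨n', x', hn', -, -, hdu, hdv, hcard⟩ :=
    card_cellFamily_le_records hu hv (towerAlphabet_range_of_le halph) hED hdis R S hS
  exact hcard.trans (hlaw m n' t D _ _ x' d hdu hdv hn')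

/-- **THE TRANSFER (A_E) ⇒ (B_E): `SparseLevelRecordLaw ℓ → SparseLevelCarrierLaw ℓ`**, with the same constants, for every `ℓ` (typed target
`sparseLevelCarrier_of_sparseLevelRecord` of ✓ `…TowerRecordDefs` §9b).  HONEST LABEL: feeds a wider CLASS rung (boundedly many levels, height-free),
inert as a hatch; VP ≠ VNP is NOT proved. [folklore] -/
theorem sparseLevelCarrier_of_sparseLevelRecord_holds (ℓ : ℕ) : sparseLevelCarrier_of_sparseLevelRecord ℓ := by
  classical
  rintro ⟨a, b, hlaw⟩
  refine ⟨a, b, fun m t n D u v x d E hEℓ hED _ht hu hv halph hdis R S hS => ?_⟩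
  obtain ⟨n', x', hn', hlu, hlv, hdu, hdv, hcard⟩ := card_cellFamily_le_records hu hv halph hED hdis R S hS
  exact hcard.trans (hlaw m n' t D _ _ x' d E hEℓ hlu hlv hdu hdv hn')

end Glue

end RecordFile

end Summit.ValiantsHypothesis.ValiantsHypothesis.Theorems.NewtonUnitEquations.TwoProducts.TowerRecord.Lift

end
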